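/-
Copyright (c) 2026. All rights reserved.
Released under Apache 2.0 license as described in the file LICENSE.
Authors: HodgeCM publication cell (pub/hodgecm-mathlib), Track B, seat K2E3-p25 (g0).
-/
import Summits.HodgeConjecture.HodgeConjecture.Theorems.K2E3GL3BruhatCellFunctionals      -- ★ E3β₃a (inducing character, cells s₁, s₂)
import Summits.HodgeConjecture.HodgeConjecture.Theorems.K2E3GL3BruhatCellHaar             -- ★ E3β₂ (coordinates, measures, retractions)
import Literature.NumberTheory.Automorphic.ParabolicGLExactProofs                          -- ★ `IsSmooth.twist_comp_leviProjection`
import Literature.NumberTheory.Automorphic.IrreducibleClasses                              -- ★ `IsSmooth.twist`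
import Literature.NumberTheory.Automorphic.SmoothIndClosedCellNonzero                      -- ★ `ParabolicTriple.rootDeltaChar_eq_one_of_mem_N`
import Literature.NumberTheory.Automorphic.UnipotentRadicalCompactOpenProofs               -- ★ `IsLimitOfCompactOpen.of_le`, `isClosed_unipotentRadicalGL`
import Literature.NumberTheory.Automorphic.GLnLeviOrbitalDescent                           -- ★ `isClosed_standardLeviGL`
import Summits.HodgeConjecture.HodgeConjecture.Theorems.K2E3GL3BorelModulus                -- ★ `rootDeltaChar_borel_three`
import HarnessLib

/-!
# K2_E3 road (h413), leaf (nsc-S-A′), brick E3β₃c — the closed and the open cell of `GL₃` contribute exactly a line each to `r_U(Ind_B^{GL₃} χδ^{1/2})`, with exponent `χ ∘ Ad(P_w)`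
Cell `pub/hodgecm-mathlib` (D-0151), Track B, seat K2E3-p25 (g0).  `--supports stmt-HodgeConjecture-24833 --as helper`; THEOREMS ONLY; COUNT-NEUTRAL.
For the inducing character `σ′ = (χ ∘ levi)·δ_B^{1/2}` of ★ `parabolicIndGL F id (𝟙.twist χ)` and a permutation `w ∈ S₃`, the hypotheses `hinv` (U-invariance of the Haar functional
`∫_{Γ_w} f(P_w γ)dγ` on `X^<_w`) and `hT` (torus equivariance with character `e_w = (χ ∘ levi ∘ Ad(P_w) ∘ diag)·(δ_B^{1/2} ∘ diag)` — the modulus of `γ ↦ diag⁻¹ γ diag` on `Γ_w` being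
EXACTLY `δ_B^{1/2}(diag)/δ_B^{1/2}(P_w diag P_w⁻¹)`, ★ `rootDeltaChar_borel_three`) of ★ E3γ2 are discharged from ★ E3β₁∕E3β₂; output per cell: a functional `Λ_w` on `J` with
`ker Λ_w ∩ F^<_w = F^≤_w`, `Λ_w ≠ 0` on `F^<_w`, and `Λ_w(r(m)x) = χ(levi(P_w diag(m) P_w⁻¹))·Λ_w(x)` — the exponent of cell `w` is `χ ∘ Ad(P_w)`, with NO modulus factor left.
HONEST LABEL: HC_CM is proved only modulo the 7 printed citations (2 remaining named inputs: hLiu418 = stmt-HodgeConjecture-24832, h413 = stmt-HodgeConjecture-24833) until rung 0 closes.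
## References
* [BernsteinZelevinsky1977] I. N. Bernstein, A. V. Zelevinsky, *Induced representations of reductive p-adic groups I*, Ann. Sci. ÉNS 10 (1977), 1.7–1.9, §2.3, Thm. 5.2.
* [Casselman1995] W. Casselman, *Introduction to the theory of admissible representations of p-adic reductive groups* (draft 1995), §1.5, §6.3 (Thm. 6.3.5).
-/

set_option autoImplicit false
set_option linter.dupNamespace false

noncomputable section

open Set Function MeasureTheory Measure Filter Representation
open scoped MatrixGroups NNReal ENNReal

namespace Summit.HodgeConjecture.HodgeConjecture.Cruxes.H413.K2E3GL3BruhatCellFunctionalsExtremes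

open Literature.NumberTheory.Automorphic ValuativeRel
open Literature.NumberTheory.GaloisRepresentations Literature.NumberTheory.GaloisRepresentations.IsNonarchimedeanLocalField
open Summit.HodgeConjecture.HodgeConjecture.Cruxes.H413.K2E3GL3BorelUnipotentHaar
open Summit.HodgeConjecture.HodgeConjecture.Cruxes.H413.K2E3GL3BruhatCellSubgroups
open Summit.HodgeConjecture.HodgeConjecture.Cruxes.H413.K2E3GL3BruhatCellHaar
open Summit.HodgeConjecture.HodgeConjecture.Cruxes.H413.K2E3BorelCellJacquetLine
open Summit.HodgeConjecture.HodgeConjecture.Cruxes.H413.K2E3BorelCellCoinvariantsBound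
open Summit.HodgeConjecture.HodgeConjecture.Cruxes.H413.K2E3GL3BruhatCellFunctionals

variable {F : Type} [Field F] [ValuativeRel F] [TopologicalSpace F] [IsNonarchimedeanLocalField F]

/-! ## §2 The closed cell `w = 1`: `Γ = 1`, `S = U`, `μ = δ_1` -/

/-- **The closed cell contributes exactly a line, with exponent `χ`** (`= χ ∘ Ad(P_1)`): the Haar functional is evaluation `f ↦ f(1)` (Dirac measure on `Γ = 1`),
`hinv`∕`hT` are `f(u) = f(1)` and `f(t) = σ′(t) f(1)`. [cite: BernsteinZelevinsky1977, Thm. 5.2] [cite: Casselman1995, §6.3, Thm. 6.3.5] -/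
theorem exists_lineFunctional_cell_one (χ : (Π a : Fin 3, GL {i : Fin 3 // (id : Fin 3 → Fin 3) i = a} F) →* ℂˣ) (hχ : IsOpen (χ.ker : Set (Π a : Fin 3, GL {i : Fin 3 // (id : Fin 3 → Fin 3) i = a} F))) :
    let σ' := Representation.twist (((Representation.trivial ℂ (Π a : Fin 3, GL {i : Fin 3 // (id : Fin 3 → Fin 3) i = a} F) ℂ).twist χ).comp (leviProjection F (id : Fin 3 → Fin 3))) (rootDeltaChar (standardParabolicGL F (id : Fin 3 → Fin 3)))
    let I := smoothIndRep (standardParabolicGL F (id : Fin 3 → Fin 3)) σ'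
    let mk := Coinvariants.mk (restrictUnipotentGL F (id : Fin 3 → Fin 3) I)
    let Flt := (vanishingOn (standardParabolicGL F (id : Fin 3 → Fin 3)) σ' (cellLT (K := F) (id : Fin 3 → Fin 3) ((1 : Equiv.Perm (Fin 3))))).map mk
    let Fle := (vanishingOn (standardParabolicGL F (id : Fin 3 → Fin 3)) σ' (cellLE (K := F) (id : Fin 3 → Fin 3) ((1 : Equiv.Perm (Fin 3))))).map mk
    ∃ Λ : (restrictUnipotentGL F (id : Fin 3 → Fin 3) I).Coinvariants →ₗ[ℂ] ℂ,
      (∀ x ∈ Flt, Λ x = 0 ↔ x ∈ Fle) ∧ (∃ x ∈ Flt, Λ x ≠ 0) ∧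
      ∀ (m : (Π a : Fin 3, GL {i : Fin 3 // (id : Fin 3 → Fin 3) i = a} F)), ∀ x ∈ Flt,
        Λ (Representation.normalizedJacquetGL F (id : Fin 3 → Fin 3) I m x) =
          ((χ (leviProjection F (id : Fin 3 → Fin 3) ⟨(permGL ((1 : Equiv.Perm (Fin 3))) : GL (Fin 3) F) * blockDiagonalGL F (id : Fin 3 → Fin 3) m * (permGL ((1 : Equiv.Perm (Fin 3))) : GL (Fin 3) F)⁻¹, permGL_conj_blockDiagonalGL_mem_borel ((1 : Equiv.Perm (Fin 3))) m⟩) : ℂˣ) : ℂ) * Λ x := by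
  intro σ' I mk Flt Fle
  haveI : T2Space F := (isLocalField F).toT2Space
  haveI : LocallyCompactSpace F := (isLocalField F).toLocallyCompactSpace
  haveI : SecondCountableTopology F := secondCountableTopology_localField F
  letI : MeasurableSpace F := borel F
  haveI : BorelSpace F := ⟨rfl⟩
  obtain ⟨hΓlow, hS, hSB, hdec⟩ := cellDatum_one (F := F)
  have hΓU : (⊥ : Subgroup (GL (Fin 3) F)) ≤ upperUnitriangular (Fin 3) F := bot_le
  have hΓcl : IsClosed (((⊥ : Subgroup (GL (Fin 3) F)) : Subgroup (GL (Fin 3) F)) : Set (GL (Fin 3) F)) := by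
    rw [Subgroup.coe_bot]; exact isClosed_singleton
  have hΓlim : IsLimitOfCompactOpen ↥(⊥ : Subgroup (GL (Fin 3) F)) := (isLimitOfCompactOpen_upperUnitriangular F 3).of_le hΓU hΓcl
  letI : MeasurableSpace ↥(⊥ : Subgroup (GL (Fin 3) F)) := borel _
  haveI : BorelSpace ↥(⊥ : Subgroup (GL (Fin 3) F)) := ⟨rfl⟩
  haveI : MeasurableSingletonClass ↥(⊥ : Subgroup (GL (Fin 3) F)) := ⟨fun x => by
    rw [show ({x} : Set ↥(⊥ : Subgroup (GL (Fin 3) F))) = Set.univ from Set.eq_univ_of_forall fun y => Subsingleton.elim y x]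
    exact MeasurableSet.univ⟩
  haveI : IsFiniteMeasureOnCompacts (Measure.dirac (1 : ↥(⊥ : Subgroup (GL (Fin 3) F)))) := ⟨fun K _ => measure_lt_top _ _⟩
  haveI : (Measure.dirac (1 : ↥(⊥ : Subgroup (GL (Fin 3) F)))).IsMulRightInvariant := ⟨fun g => by
    rw [Subsingleton.elim g 1, show (fun x : ↥(⊥ : Subgroup (GL (Fin 3) F)) => x * 1) = id from funext fun x => mul_one x, Measure.map_id]⟩
  haveI : (Measure.dirac (1 : ↥(⊥ : Subgroup (GL (Fin 3) F)))).IsOpenPosMeasure := ⟨fun V hV hne => by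
    obtain ⟨x, hx⟩ := hne
    rw [Subsingleton.elim x 1] at hx
    rw [Measure.dirac_apply_of_mem hx]; exact one_ne_zero⟩
  have hP : (permGL ((1 : Equiv.Perm (Fin 3))) : GL (Fin 3) F) = 1 := permGL_one
  let conjB : (Π a : Fin 3, GL {i : Fin 3 // (id : Fin 3 → Fin 3) i = a} F) →* ↥(standardParabolicGL F (id : Fin 3 → Fin 3)) :=
    ((MulAut.conj (permGL ((1 : Equiv.Perm (Fin 3))) : GL (Fin 3) F)).toMonoidHom.comp (blockDiagonalGL F (id : Fin 3 → Fin 3))).codRestrict (standardParabolicGL F (id : Fin 3 → Fin 3))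
      (fun m => permGL_conj_blockDiagonalGL_mem_borel ((1 : Equiv.Perm (Fin 3))) m)
  let ew : (Π a : Fin 3, GL {i : Fin 3 // (id : Fin 3 → Fin 3) i = a} F) →* ℂˣ := (χ.comp ((leviProjection F (id : Fin 3 → Fin 3)).comp conjB)) *
    (rootDeltaChar (standardParabolicGL F (id : Fin 3 → Fin 3))).comp (leviEmbeddingP F (id : Fin 3 → Fin 3))
  obtain ⟨Λ, hker, hne, hequiv⟩ := exists_lineFunctional_of_cellDatum σ' (1 : Equiv.Perm (Fin 3)) (⊥ : Subgroup (GL (Fin 3) F)) (upperUnitriangular (Fin 3) F) (isSmooth_inducingChar χ hχ)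
    hΓU hΓcl hΓlim hΓlow hS hSB hdec (fun _ => 1) continuous_const (fun s hs _ γ => Subsingleton.elim _ _) (Measure.dirac (1 : ↥(⊥ : Subgroup (GL (Fin 3) F))))
    (by
      intro u hu f hf
      rw [integral_dirac, integral_dirac]
      simp only [toFun_smoothIndRep_apply, hP, Subgroup.coe_one, mul_one, one_mul]
      have h := SmoothInd.toFun_subgroup_mul f ⟨u, unipotentRadicalGL_le F (id : Fin 3 → Fin 3) hu⟩ 1
      rw [mul_one] at h
      exact h.trans (inducingChar_apply_of_mem_upperUnitriangular χ hu _)) ew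
    (by
      intro m f hf
      rw [integral_dirac, integral_dirac]
      simp only [toFun_smoothIndRep_apply, hP, Subgroup.coe_one, mul_one, one_mul]
      have h := SmoothInd.toFun_subgroup_mul f (leviEmbeddingP F (id : Fin 3 → Fin 3) m) 1
      rw [mul_one, coe_leviEmbeddingP] at h
      have hconj1 : conjB m = leviEmbeddingP F (id : Fin 3 → Fin 3) m :=
        Subtype.ext (show (permGL ((1 : Equiv.Perm (Fin 3))) : GL (Fin 3) F) * blockDiagonalGL F (id : Fin 3 → Fin 3) m * (permGL ((1 : Equiv.Perm (Fin 3))) : GL (Fin 3) F)⁻¹ = ((leviEmbeddingP F (id : Fin 3 → Fin 3) m : ↥(standardParabolicGL F (id : Fin 3 → Fin 3))) : GL (Fin 3) F) by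
          rw [coe_leviEmbeddingP, hP, one_mul, inv_one, mul_one])
      have hew : ((ew m : ℂˣ) : ℂ) = ((χ m : ℂˣ) : ℂ) * ((rootDeltaChar (standardParabolicGL F (id : Fin 3 → Fin 3)) (leviEmbeddingP F (id : Fin 3 → Fin 3) m) : ℂˣ) : ℂ) := by
        simp only [ew, MonoidHom.mul_apply, MonoidHom.coe_comp, Function.comp_apply, Units.val_mul, hconj1, leviProjection_leviEmbeddingP_apply]
      rw [h, inducingChar_apply, leviProjection_leviEmbeddingP_apply, hew]
      ring)
  refine ⟨Λ, hker, hne, fun m x hx => ?_⟩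
  rw [hequiv m x hx]
  congr 2
  have hew' : ew * ((rootDeltaChar (standardParabolicGL F (id : Fin 3 → Fin 3))).comp (leviEmbeddingP F (id : Fin 3 → Fin 3)))⁻¹ =
      χ.comp ((leviProjection F (id : Fin 3 → Fin 3)).comp conjB) := by
    ext n
    simp only [ew, MonoidHom.mul_apply, MonoidHom.inv_apply, MonoidHom.coe_comp, Function.comp_apply, mul_inv_cancel_right]
  rw [hew']
  rfl

/-! ## §3 The open cell `w₀ = rev`: `Γ = U ≅ (F × F) × F`, `S = 1`, `μ` = Haar of `U₃` in coordinates (★ p11) -/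

/-- **The open cell contributes exactly a line, with exponent `χ ∘ Ad(P_{w₀})`** (`hinv` = right invariance of the Haar measure of `U₃`; `hT` by the diagonal scaling
`(x,y,z) ↦ ((d₁/d₀)x, (d₂/d₁)y, (d₂/d₀)z)` of module `‖d₀‖²‖d₂‖⁻² = δ^{1/2}(diag)/δ^{1/2}(P_{w₀} diag P_{w₀}⁻¹)`, ★ `map_coordScale`).
[cite: BernsteinZelevinsky1977, Thm. 5.2] [cite: Casselman1995, §6.3, Thm. 6.3.5] -/
theorem exists_lineFunctional_cell_rev (χ : (Π a : Fin 3, GL {i : Fin 3 // (id : Fin 3 → Fin 3) i = a} F) →* ℂˣ) (hχ : IsOpen (χ.ker : Set (Π a : Fin 3, GL {i : Fin 3 // (id : Fin 3 → Fin 3) i = a} F))) :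
    let σ' := Representation.twist (((Representation.trivial ℂ (Π a : Fin 3, GL {i : Fin 3 // (id : Fin 3 → Fin 3) i = a} F) ℂ).twist χ).comp (leviProjection F (id : Fin 3 → Fin 3))) (rootDeltaChar (standardParabolicGL F (id : Fin 3 → Fin 3)))
    let I := smoothIndRep (standardParabolicGL F (id : Fin 3 → Fin 3)) σ'
    let mk := Coinvariants.mk (restrictUnipotentGL F (id : Fin 3 → Fin 3) I)
    let Flt := (vanishingOn (standardParabolicGL F (id : Fin 3 → Fin 3)) σ' (cellLT (K := F) (id : Fin 3 → Fin 3) ((Fin.revPerm : Equiv.Perm (Fin 3))))).map mk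
    let Fle := (vanishingOn (standardParabolicGL F (id : Fin 3 → Fin 3)) σ' (cellLE (K := F) (id : Fin 3 → Fin 3) ((Fin.revPerm : Equiv.Perm (Fin 3))))).map mk
    ∃ Λ : (restrictUnipotentGL F (id : Fin 3 → Fin 3) I).Coinvariants →ₗ[ℂ] ℂ,
      (∀ x ∈ Flt, Λ x = 0 ↔ x ∈ Fle) ∧ (∃ x ∈ Flt, Λ x ≠ 0) ∧
      ∀ (m : (Π a : Fin 3, GL {i : Fin 3 // (id : Fin 3 → Fin 3) i = a} F)), ∀ x ∈ Flt,
        Λ (Representation.normalizedJacquetGL F (id : Fin 3 → Fin 3) I m x) =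
          ((χ (leviProjection F (id : Fin 3 → Fin 3) ⟨(permGL ((Fin.revPerm : Equiv.Perm (Fin 3))) : GL (Fin 3) F) * blockDiagonalGL F (id : Fin 3 → Fin 3) m * (permGL ((Fin.revPerm : Equiv.Perm (Fin 3))) : GL (Fin 3) F)⁻¹, permGL_conj_blockDiagonalGL_mem_borel ((Fin.revPerm : Equiv.Perm (Fin 3))) m⟩) : ℂˣ) : ℂ) * Λ x := by
  intro σ' I mk Flt Fle
  haveI : T2Space F := (isLocalField F).toT2Space
  haveI : LocallyCompactSpace F := (isLocalField F).toLocallyCompactSpace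
  haveI : SecondCountableTopology F := secondCountableTopology_localField F
  letI : MeasurableSpace F := borel F
  haveI : BorelSpace F := ⟨rfl⟩
  obtain ⟨hΓlow, hS, hSB, hdec⟩ := cellDatum_rev (F := F)
  have hΓU : unipotentRadicalGL F (id : Fin 3 → Fin 3) ≤ upperUnitriangular (Fin 3) F := le_rfl
  have hΓcl : IsClosed ((unipotentRadicalGL F (id : Fin 3 → Fin 3) : Subgroup (GL (Fin 3) F)) : Set (GL (Fin 3) F)) := isClosed_unipotentRadicalGL _
  have hΓlim : IsLimitOfCompactOpen ↥(unipotentRadicalGL F (id : Fin 3 → Fin 3)) := isLimitOfCompactOpen_upperUnitriangular F 3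
  obtain ⟨e, he⟩ := exists_coordHomeomorph (R := F)
  letI : MeasurableSpace ↥(unipotentRadicalGL F (id : Fin 3 → Fin 3)) := borel _
  haveI : BorelSpace ↥(unipotentRadicalGL F (id : Fin 3 → Fin 3)) := ⟨rfl⟩
  haveI := isHaarMeasure_map_coord e he (Measure.addHaar : Measure F)
  haveI := isMulRightInvariant_map_coord e he (Measure.addHaar : Measure F)
  have hme : MeasurableEmbedding e := e.measurableEmbedding
  let conjB : (Π a : Fin 3, GL {i : Fin 3 // (id : Fin 3 → Fin 3) i = a} F) →* ↥(standardParabolicGL F (id : Fin 3 → Fin 3)) :=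
    ((MulAut.conj (permGL ((Fin.revPerm : Equiv.Perm (Fin 3))) : GL (Fin 3) F)).toMonoidHom.comp (blockDiagonalGL F (id : Fin 3 → Fin 3))).codRestrict (standardParabolicGL F (id : Fin 3 → Fin 3))
      (fun m => permGL_conj_blockDiagonalGL_mem_borel ((Fin.revPerm : Equiv.Perm (Fin 3))) m)
  let ew : (Π a : Fin 3, GL {i : Fin 3 // (id : Fin 3 → Fin 3) i = a} F) →* ℂˣ := (χ.comp ((leviProjection F (id : Fin 3 → Fin 3)).comp conjB)) *
    (rootDeltaChar (standardParabolicGL F (id : Fin 3 → Fin 3))).comp (leviEmbeddingP F (id : Fin 3 → Fin 3))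
  obtain ⟨Λ, hker, hne, hequiv⟩ := exists_lineFunctional_of_cellDatum σ' (Fin.revPerm : Equiv.Perm (Fin 3)) (unipotentRadicalGL F (id : Fin 3 → Fin 3)) (⊥ : Subgroup (GL (Fin 3) F)) (isSmooth_inducingChar χ hχ)
    hΓU hΓcl hΓlim hΓlow hS hSB hdec (fun u => u) continuous_id
    (fun s hs hs1 γ => Subtype.ext (show s * ((γ : ↥(unipotentRadicalGL F (id : Fin 3 → Fin 3))) : GL (Fin 3) F) = γ by rw [Subgroup.mem_bot.1 hs1, one_mul])) ((((Measure.addHaar : Measure F).prod (Measure.addHaar : Measure F)).prod (Measure.addHaar : Measure F)).map e)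
    (by
      intro u hu f hf
      obtain ⟨s₀, hs₀, γ₀, hγ₀, rfl⟩ := hdec u hu
      rw [Subgroup.mem_bot.1 hs₀, one_mul]
      have hfun : (fun γ : ↥(unipotentRadicalGL F (id : Fin 3 → Fin 3)) => (smoothIndRep (standardParabolicGL F (id : Fin 3 → Fin 3)) σ' γ₀ f).toFun ((permGL ((Fin.revPerm : Equiv.Perm (Fin 3))) : GL (Fin 3) F) * ((γ : ↥(unipotentRadicalGL F (id : Fin 3 → Fin 3))) : GL (Fin 3) F))) =
          fun γ => f.toFun ((permGL ((Fin.revPerm : Equiv.Perm (Fin 3))) : GL (Fin 3) F) * (((γ * ⟨γ₀, hγ₀⟩ : ↥(unipotentRadicalGL F (id : Fin 3 → Fin 3)))) : GL (Fin 3) F)) := by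
        funext γ
        rw [toFun_smoothIndRep_apply, mul_assoc]
        rfl
      rw [hfun]
      exact integral_mul_right_eq_self (fun γ : ↥(unipotentRadicalGL F (id : Fin 3 → Fin 3)) => f.toFun ((permGL ((Fin.revPerm : Equiv.Perm (Fin 3))) : GL (Fin 3) F) * ((γ : ↥(unipotentRadicalGL F (id : Fin 3 → Fin 3))) : GL (Fin 3) F))) ⟨γ₀, hγ₀⟩) ew
    (by
      intro m f hf
      have hd0 := blockDiagonalGL_id_three_apply_ne_zero m 0
      have hd1 := blockDiagonalGL_id_three_apply_ne_zero m 1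
      have hd2 := blockDiagonalGL_id_three_apply_ne_zero m 2
      have hmemB : (permGL ((Fin.revPerm : Equiv.Perm (Fin 3))) : GL (Fin 3) F) * blockDiagonalGL F (id : Fin 3 → Fin 3) m * (permGL ((Fin.revPerm : Equiv.Perm (Fin 3))) : GL (Fin 3) F)⁻¹ ∈ standardParabolicGL F (id : Fin 3 → Fin 3) := permGL_conj_blockDiagonalGL_mem_borel (Fin.revPerm : Equiv.Perm (Fin 3)) m
      have hfun : (fun γ : ↥(unipotentRadicalGL F (id : Fin 3 → Fin 3)) => (smoothIndRep (standardParabolicGL F (id : Fin 3 → Fin 3)) σ' (blockDiagonalGL F (id : Fin 3 → Fin 3) m) f).toFun ((permGL ((Fin.revPerm : Equiv.Perm (Fin 3))) : GL (Fin 3) F) * ((γ : ↥(unipotentRadicalGL F (id : Fin 3 → Fin 3))) : GL (Fin 3) F))) =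
          fun γ => (((rootDeltaChar (standardParabolicGL F (id : Fin 3 → Fin 3)) ⟨_, hmemB⟩ : ℂˣ) : ℂ) * (((χ (leviProjection F (id : Fin 3 → Fin 3) ⟨_, hmemB⟩)) : ℂˣ) : ℂ)) *
            f.toFun ((permGL ((Fin.revPerm : Equiv.Perm (Fin 3))) : GL (Fin 3) F) * ((blockDiagonalGL F (id : Fin 3 → Fin 3) m)⁻¹ * ((γ : ↥(unipotentRadicalGL F (id : Fin 3 → Fin 3))) : GL (Fin 3) F) * blockDiagonalGL F (id : Fin 3 → Fin 3) m)) := by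
        funext γ
        rw [toFun_smoothIndRep_apply]
        have hprod : (permGL ((Fin.revPerm : Equiv.Perm (Fin 3))) : GL (Fin 3) F) * ((γ : ↥(unipotentRadicalGL F (id : Fin 3 → Fin 3))) : GL (Fin 3) F) * blockDiagonalGL F (id : Fin 3 → Fin 3) m = ((permGL ((Fin.revPerm : Equiv.Perm (Fin 3))) : GL (Fin 3) F) * blockDiagonalGL F (id : Fin 3 → Fin 3) m * (permGL ((Fin.revPerm : Equiv.Perm (Fin 3))) : GL (Fin 3) F)⁻¹) * ((permGL ((Fin.revPerm : Equiv.Perm (Fin 3))) : GL (Fin 3) F) * ((blockDiagonalGL F (id : Fin 3 → Fin 3) m)⁻¹ * ((γ : ↥(unipotentRadicalGL F (id : Fin 3 → Fin 3))) : GL (Fin 3) F) * blockDiagonalGL F (id : Fin 3 → Fin 3) m)) := by group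
        rw [hprod]
        refine (SmoothInd.toFun_subgroup_mul f ⟨_, hmemB⟩ _).trans ?_
        rw [inducingChar_apply]
        exact (mul_assoc _ _ _).symm
      rw [hfun, integral_const_mul]
      have hα : (((blockDiagonalGL F (id : Fin 3 → Fin 3) m : GL (Fin 3) F) : Matrix (Fin 3) (Fin 3) F) 1 1 / ((blockDiagonalGL F (id : Fin 3 → Fin 3) m : GL (Fin 3) F) : Matrix (Fin 3) (Fin 3) F) 0 0) ≠ 0 := div_ne_zero hd1 hd0
      have hβ : (((blockDiagonalGL F (id : Fin 3 → Fin 3) m : GL (Fin 3) F) : Matrix (Fin 3) (Fin 3) F) 2 2 / ((blockDiagonalGL F (id : Fin 3 → Fin 3) m : GL (Fin 3) F) : Matrix (Fin 3) (Fin 3) F) 1 1) ≠ 0 := div_ne_zero hd2 hd1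
      have hγ : (((blockDiagonalGL F (id : Fin 3 → Fin 3) m : GL (Fin 3) F) : Matrix (Fin 3) (Fin 3) F) 2 2 / ((blockDiagonalGL F (id : Fin 3 → Fin 3) m : GL (Fin 3) F) : Matrix (Fin 3) (Fin 3) F) 0 0) ≠ 0 := div_ne_zero hd2 hd0
      have hconj : ∀ p : (F × F) × F, (blockDiagonalGL F (id : Fin 3 → Fin 3) m)⁻¹ * ((e p : ↥(unipotentRadicalGL F (id : Fin 3 → Fin 3))) : GL (Fin 3) F) * blockDiagonalGL F (id : Fin 3 → Fin 3) m =
          ((e (((((blockDiagonalGL F (id : Fin 3 → Fin 3) m : GL (Fin 3) F) : Matrix (Fin 3) (Fin 3) F) 1 1 / ((blockDiagonalGL F (id : Fin 3 → Fin 3) m : GL (Fin 3) F) : Matrix (Fin 3) (Fin 3) F) 0 0) * p.1.1, (((blockDiagonalGL F (id : Fin 3 → Fin 3) m : GL (Fin 3) F) : Matrix (Fin 3) (Fin 3) F) 2 2 / ((blockDiagonalGL F (id : Fin 3 → Fin 3) m : GL (Fin 3) F) : Matrix (Fin 3) (Fin 3) F) 1 1) * p.1.2), (((blockDiagonalGL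 F (id : Fin 3 → Fin 3) m : GL (Fin 3) F) : Matrix (Fin 3) (Fin 3) F) 2 2 / ((blockDiagonalGL F (id : Fin 3 → Fin 3) m : GL (Fin 3) F) : Matrix (Fin 3) (Fin 3) F) 0 0) * p.2) : ↥(unipotentRadicalGL F (id : Fin 3 → Fin 3))) : GL (Fin 3) F) := by
        intro p
        rw [blockDiagonalGL_inv_mul_coord_mul e he m p]
        congr 2
        ext <;> simp <;> ring
      have hsub : ∫ γ, f.toFun ((permGL ((Fin.revPerm : Equiv.Perm (Fin 3))) : GL (Fin 3) F) * ((blockDiagonalGL F (id : Fin 3 → Fin 3) m)⁻¹ * ((γ : ↥(unipotentRadicalGL F (id : Fin 3 → Fin 3))) : GL (Fin 3) F) * blockDiagonalGL F (id : Fin 3 → Fin 3) m)) ∂((((Measure.addHaar : Measure F).prod (Measure.addHaar : Measure F)).prod (Measure.addHaar : Measure F)).map e) =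
          ((normAbs F (((blockDiagonalGL F (id : Fin 3 → Fin 3) m : GL (Fin 3) F) : Matrix (Fin 3) (Fin 3) F) 1 1 / ((blockDiagonalGL F (id : Fin 3 → Fin 3) m : GL (Fin 3) F) : Matrix (Fin 3) (Fin 3) F) 0 0)⁻¹ * normAbs F (((blockDiagonalGL F (id : Fin 3 → Fin 3) m : GL (Fin 3) F) : Matrix (Fin 3) (Fin 3) F) 2 2 / ((blockDiagonalGL F (id : Fin 3 → Fin 3) m : GL (Fin 3) F) : Matrix (Fin 3) (Fin 3) F) 1 1)⁻¹ * normAbs F (((blockDiagonalGL F (id : Fin 3 → Fin 3) m : GL (Fin 3) F) : Matrix (Fin 3) (Fin 3) F) 2 2 / ((blockDiagonalGL F (id : Fin 3 → Fin 3) m : GL (Fin 3) F) : Matrix (Fin 3) (Fin 3) F) 0 0)⁻¹ : ℝ≥0) : ℝ) *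
            ∫ γ, f.toFun ((permGL ((Fin.revPerm : Equiv.Perm (Fin 3))) : GL (Fin 3) F) * ((γ : ↥(unipotentRadicalGL F (id : Fin 3 → Fin 3))) : GL (Fin 3) F)) ∂((((Measure.addHaar : Measure F).prod (Measure.addHaar : Measure F)).prod (Measure.addHaar : Measure F)).map e) := by
        rw [hme.integral_map, hme.integral_map]
        simp_rw [hconj]
        have hmap := map_coordScale (Measure.addHaar : Measure F) hα hβ hγ
        have heq := integral_map_equiv ((((Homeomorph.mulLeft₀ _ hα).prodCongr (Homeomorph.mulLeft₀ _ hβ)).prodCongr (Homeomorph.mulLeft₀ _ hγ)).toMeasurableEquiv)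
          (fun p : (F × F) × F => f.toFun ((permGL ((Fin.revPerm : Equiv.Perm (Fin 3))) : GL (Fin 3) F) * ((e p : ↥(unipotentRadicalGL F (id : Fin 3 → Fin 3))) : GL (Fin 3) F))) (μ := (((Measure.addHaar : Measure F).prod (Measure.addHaar : Measure F)).prod (Measure.addHaar : Measure F)))
        rw [Homeomorph.toMeasurableEquiv_coe] at heq
        change ∫ y, f.toFun ((permGL ((Fin.revPerm : Equiv.Perm (Fin 3))) : GL (Fin 3) F) * ((e y : ↥(unipotentRadicalGL F (id : Fin 3 → Fin 3))) : GL (Fin 3) F)) ∂((((Measure.addHaar : Measure F).prod (Measure.addHaar : Measure F)).prod (Measure.addHaar : Measure F)).map (fun p : (F × F) × F => (((((blockDiagonalGL F (id : Fin 3 → Fin 3) m : GL (Fin 3) F) : Matrix (Fin 3) (Fin 3) F) 1 1 / ((blockDiagonalGL F (id : Fin 3 → Fin 3) m : GL (Fin 3) F) : Matrix (Fin 3) (Fin 3) F) 0 0) * p.1.1, (((blockDiagonalGL F (id : Fin 3 → Fin 3) m : GL (Fin 3) F) : Matrix (Fin 3) (Fin 3) F) 2 2 / ((blockDiagonalGL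 F (id : Fin 3 → Fin 3) m : GL (Fin 3) F) : Matrix (Fin 3) (Fin 3) F) 1 1) * p.1.2), (((blockDiagonalGL F (id : Fin 3 → Fin 3) m : GL (Fin 3) F) : Matrix (Fin 3) (Fin 3) F) 2 2 / ((blockDiagonalGL F (id : Fin 3 → Fin 3) m : GL (Fin 3) F) : Matrix (Fin 3) (Fin 3) F) 0 0) * p.2))) =
          ∫ p, f.toFun ((permGL ((Fin.revPerm : Equiv.Perm (Fin 3))) : GL (Fin 3) F) * ((e (((((blockDiagonalGL F (id : Fin 3 → Fin 3) m : GL (Fin 3) F) : Matrix (Fin 3) (Fin 3) F) 1 1 / ((blockDiagonalGL F (id : Fin 3 → Fin 3) m : GL (Fin 3) F) : Matrix (Fin 3) (Fin 3) F) 0 0) * p.1.1, (((blockDiagonalGL F (id : Fin 3 → Fin 3) m : GL (Fin 3) F) : Matrix (Fin 3) (Fin 3) F) 2 2 / ((blockDiagonalGL F (id : Fin 3 → Fin 3) m : GL (Fin 3) F) : Matrix (Fin 3) (Fin 3) F) 1 1) * p.1.2), (((blockDiagonalGL F (id : Fin 3 → Fin 3) m : GL (Fin 3) F) : Matrix (Fin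 3) (Fin 3) F) 2 2 / ((blockDiagonalGL F (id : Fin 3 → Fin 3) m : GL (Fin 3) F) : Matrix (Fin 3) (Fin 3) F) 0 0) * p.2) : ↥(unipotentRadicalGL F (id : Fin 3 → Fin 3))) : GL (Fin 3) F)) ∂(((Measure.addHaar : Measure F).prod (Measure.addHaar : Measure F)).prod (Measure.addHaar : Measure F)) at heq
        rw [← heq, hmap, integral_smul_measure, ENNReal.coe_toReal, Complex.real_smul]
      rw [hsub]
      have hw0 : (Fin.revPerm : Equiv.Perm (Fin 3)) 0 = 2 := by decide
      have hw2 : (Fin.revPerm : Equiv.Perm (Fin 3)) 2 = 0 := by decide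
      have hew : ((ew m : ℂˣ) : ℂ) = (((χ (leviProjection F (id : Fin 3 → Fin 3) ⟨_, hmemB⟩)) : ℂˣ) : ℂ) *
          ((rootDeltaChar (standardParabolicGL F (id : Fin 3 → Fin 3)) (leviEmbeddingP F (id : Fin 3 → Fin 3) m) : ℂˣ) : ℂ) := by
        simp only [ew, MonoidHom.mul_apply, MonoidHom.coe_comp, Function.comp_apply, Units.val_mul]
        rfl
      have hδ1 : ((rootDeltaChar (standardParabolicGL F (id : Fin 3 → Fin 3)) ⟨_, hmemB⟩ : ℂˣ) : ℂ) =
          (((normAbs F (((blockDiagonalGL F (id : Fin 3 → Fin 3) m : GL (Fin 3) F) : Matrix (Fin 3) (Fin 3) F) 2 2) * (normAbs F (((blockDiagonalGL F (id : Fin 3 → Fin 3) m : GL (Fin 3) F) : Matrix (Fin 3) (Fin 3) F) 0 0))⁻¹ : ℝ≥0) : ℝ) : ℂ) := by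
        rw [K2E3GL3BorelModulus.rootDeltaChar_borel_three]
        simp only [permGL_conj_apply, hw0, hw2]
      have hδ2 : ((rootDeltaChar (standardParabolicGL F (id : Fin 3 → Fin 3)) (leviEmbeddingP F (id : Fin 3 → Fin 3) m) : ℂˣ) : ℂ) =
          (((normAbs F (((blockDiagonalGL F (id : Fin 3 → Fin 3) m : GL (Fin 3) F) : Matrix (Fin 3) (Fin 3) F) 0 0) * (normAbs F (((blockDiagonalGL F (id : Fin 3 → Fin 3) m : GL (Fin 3) F) : Matrix (Fin 3) (Fin 3) F) 2 2))⁻¹ : ℝ≥0) : ℝ) : ℂ) := by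
        rw [K2E3GL3BorelModulus.rootDeltaChar_borel_three, coe_leviEmbeddingP]
      have hn0 : normAbs F (((blockDiagonalGL F (id : Fin 3 → Fin 3) m : GL (Fin 3) F) : Matrix (Fin 3) (Fin 3) F) 0 0) ≠ 0 := (map_ne_zero _).2 hd0
      have hn1 : normAbs F (((blockDiagonalGL F (id : Fin 3 → Fin 3) m : GL (Fin 3) F) : Matrix (Fin 3) (Fin 3) F) 1 1) ≠ 0 := (map_ne_zero _).2 hd1
      have hn2 : normAbs F (((blockDiagonalGL F (id : Fin 3 → Fin 3) m : GL (Fin 3) F) : Matrix (Fin 3) (Fin 3) F) 2 2) ≠ 0 := (map_ne_zero _).2 hd2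
      have key : (normAbs F (((blockDiagonalGL F (id : Fin 3 → Fin 3) m : GL (Fin 3) F) : Matrix (Fin 3) (Fin 3) F) 2 2) * (normAbs F (((blockDiagonalGL F (id : Fin 3 → Fin 3) m : GL (Fin 3) F) : Matrix (Fin 3) (Fin 3) F) 0 0))⁻¹ : ℝ≥0) *
          (normAbs F (((blockDiagonalGL F (id : Fin 3 → Fin 3) m : GL (Fin 3) F) : Matrix (Fin 3) (Fin 3) F) 1 1 / ((blockDiagonalGL F (id : Fin 3 → Fin 3) m : GL (Fin 3) F) : Matrix (Fin 3) (Fin 3) F) 0 0)⁻¹ * normAbs F (((blockDiagonalGL F (id : Fin 3 → Fin 3) m : GL (Fin 3) F) : Matrix (Fin 3) (Fin 3) F) 2 2 / ((blockDiagonalGL F (id : Fin 3 → Fin 3) m : GL (Fin 3) F) : Matrix (Fin 3) (Fin 3) F) 1 1)⁻¹ * normAbs F (((blockDiagonalGL F (id : Fin 3 → Fin 3) m : GL (Fin 3) F) : Matrix (Fin 3) (Fin 3) F) 2 2 / ((blockDiagonalGL F (id : Fin 3 → Fin 3) m : GL (Fin 3) F) : Matrix (Fin 3) (Fin 3) F)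 0 0)⁻¹) = normAbs F (((blockDiagonalGL F (id : Fin 3 → Fin 3) m : GL (Fin 3) F) : Matrix (Fin 3) (Fin 3) F) 0 0) * (normAbs F (((blockDiagonalGL F (id : Fin 3 → Fin 3) m : GL (Fin 3) F) : Matrix (Fin 3) (Fin 3) F) 2 2))⁻¹ := by
        rw [inv_div, inv_div, inv_div, map_div₀, map_div₀, map_div₀]
        field_simp
      rw [hew, hδ1, hδ2, ← key]
      push_cast
      ring)
  refine ⟨Λ, hker, hne, fun m x hx => ?_⟩
  rw [hequiv m x hx]
  congr 2
  have hew' : ew * ((rootDeltaChar (standardParabolicGL F (id : Fin 3 → Fin 3))).comp (leviEmbeddingP F (id : Fin 3 → Fin 3)))⁻¹ =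
      χ.comp ((leviProjection F (id : Fin 3 → Fin 3)).comp conjB) := by
    ext n
    simp only [ew, MonoidHom.mul_apply, MonoidHom.inv_apply, MonoidHom.coe_comp, Function.comp_apply, mul_inv_cancel_right]
  rw [hew']
  rfl

end Summit.HodgeConjecture.HodgeConjecture.Cruxes.H413.K2E3GL3BruhatCellFunctionalsExtremes
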